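import Summits.HodgeConjecture.HodgeConjecture.Theses.CyclicUnitaryPowers
import Summits.HodgeConjecture.HodgeConjecture.Theorems.CyclicUnitaryPowersCommutatorAscent
import Literature.RepresentationTheory.ClassicalInvariants.SymplecticInvolutionTensorFFT
import Literature.AlgebraicGeometry.Motives.EtaleTate

/-!
# Deck-unitary commutator invariance ascends to `ℂ`-points — tensor form (stub D₁ of crux K2-A)

Helper for the crux `PowersHodgeOfDeckCommutators` (stmt-HodgeConjecture-19545, route `CyclicUnitaryPowers`, line
`unitary-kunneth-fft` v4, lane 2 stub D `stub_deckUnitaryCommutatorDensity`).  This file transports the coordinate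
theorem `CyclicUnitaryPowersCommutatorAscent.commutator_invariance_ascends` to the tree's tensor vocabulary: for a
finite-dimensional `ℚ`-space `V` with a symmetric nondegenerate form `Q` and a `Q`-isometry `s` with `s ^ p = 1`, if a
tensor `t ∈ T^{r,0} V` (`hodgeTensorSpace V r 0`) is fixed (`tensorSpaceAct`) by every commutator of `s`-commuting
`Q`-isometries of `V`, then its image `ι t = tensorSpaceToBaseChange K V r 0 t` in `T^{r,0}_K (K ⊗ V)` is fixed
(`tensorSpaceActOver`) by the commutator of any two `K`-automorphisms `γ, δ` of `K ⊗ V` commuting with `s_K`,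
preserving `Q_K` and with `det (γ + 1)`, `det (δ + 1)` invertible (`K` any field of characteristic zero; the stub
takes `K = ℂ`).

* §1 coordinates on `T^{r,0}_K W` in a `K`-basis (the `K`-version of `SymplecticInvolutionTensorFFT` §1: basis
  monomials, synthesis, the action of `γ` through its matrix);
* §2 `ι` of a synthesized tensor is the synthesis over the base-changed basis `1 ⊗ b`;
* §3 matrices of `γ` in `1 ⊗ b`: commutation with `s_K`, `Q_K`-isometry and `det (γ + 1)` in matrix form;
* §4 the `ℚ`-side: the tensor hypothesis gives the coordinate hypothesis of `commutator_invariance_ascends`;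
* §5 `tensorSpaceActOver_commutator_eq` — the statement above.
-/

noncomputable section

open Matrix
open scoped TensorProduct PiTensorProduct BigOperators

namespace Summit.HodgeConjecture.HodgeConjecture.Theorems.CyclicUnitaryPowersDeckUnitaryCayleyAscent

open Module
open Literature.AlgebraicGeometry.Motives
open Literature.RepresentationTheory.ClassicalInvariants (basisMonomial synth synth_apply coord synth_coord
  coord_invariant noCovector eq_noCovector toMatrix_toLinearEquiv isometry_toLinearEquiv comm_toLinearEquiv)
open Literature.NumberTheory.DiophantineGeometry (tensorPowerMatrix tensorPowerMatrix_apply)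
open Summit.HodgeConjecture.HodgeConjecture.Theorems.CyclicUnitaryPowersCommutatorAscent
  (commutator_invariance_ascends)

universe u

/-! ### §1 Coordinates on `T^{r,0}_K W` -/

section CoordinatesK

variable {K : Type*} [Field K] {W : Type*} [AddCommGroup W] [Module K W]
variable {A : Type*} [Fintype A] [DecidableEq A] (β : Basis A K W) (r : ℕ)

/-- The empty family of covectors over `K`. [folklore] -/
def noCovectorK : Fin 0 → Module.Dual K W := fun i => Fin.elim0 i

omit [Fintype A] [DecidableEq A] in
/-- Any family indexed by `Fin 0` is the empty one. [folklore] -/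
theorem eq_noCovectorK (φ : Fin 0 → Module.Dual K W) : φ = noCovectorK := funext fun i => Fin.elim0 i

/-- The basis monomial `⊗ᵢ β (w i) ⊗ ()` of `T^{r,0}_K W`. [folklore] -/
def basisMonomialK (w : Fin r → A) : hodgeTensorSpaceOver K W r 0 :=
  (PiTensorProduct.tprod K fun i => β (w i)) ⊗ₜ[K] (PiTensorProduct.tprod K (noCovectorK (W := W)))

/-- Synthesis: `c ↦ Σ_w c(w) · ⊗ᵢ β (w i) ⊗ ()`. [folklore] -/
def synthK (c : (Fin r → A) → K) : hodgeTensorSpaceOver K W r 0 := ∑ w, c w • basisMonomialK β r w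

omit [DecidableEq A] in
/-- Multilinear expansion of `⊗ᵢ (Σ_a N a (w i) · β a) ⊗ ()`. [folklore] -/
theorem tprod_sum_smul_tmulK {A' : Type*} [Fintype A'] (N : Matrix A A' K) (w : Fin r → A') :
    (PiTensorProduct.tprod K fun i => ∑ a, N a (w i) • β a) ⊗ₜ[K] (PiTensorProduct.tprod K (noCovectorK (W := W))) =
      ∑ w' : Fin r → A, (∏ i, N (w' i) (w i)) • basisMonomialK β r w' := by
  have h := (PiTensorProduct.tprod K (s := fun _ : Fin r => W)).map_sum (fun i a => N a (w i) • β a)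
  rw [h, TensorProduct.sum_tmul]
  refine Finset.sum_congr rfl fun w' _ => ?_
  rw [MultilinearMap.map_smul_univ, ← TensorProduct.smul_tmul', basisMonomialK]

/-- The action of `γ ∈ GL_K(W)` on a basis monomial, through the matrix of `γ` in `β`. [folklore] -/
theorem tensorSpaceActOver_basisMonomialK (γ : W ≃ₗ[K] W) (w : Fin r → A) :
    tensorSpaceActOver γ (basisMonomialK β r w) =
      ∑ w' : Fin r → A, (∏ i, LinearMap.toMatrix β β (γ : W →ₗ[K] W) (w' i) (w i)) • basisMonomialK β r w' := by
  rw [basisMonomialK, tensorSpaceActOver_tmul_tprod, eq_noCovectorK (fun i => (noCovectorK (W := W) i) ∘ₗ _),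
    ← tprod_sum_smul_tmulK]
  congr 1
  congr 1
  funext i
  have h := Matrix.toLin_self β β (LinearMap.toMatrix β β (γ : W →ₗ[K] W)) (w i)
  rw [Matrix.toLin_toMatrix] at h
  exact h

end CoordinatesK

section CoordinatesKFin

variable {K : Type*} [Field K] {W : Type*} [AddCommGroup W] [Module K W] (r : ℕ)

/-- The action of `γ` on a synthesized tensor is the synthesis of `[γ]^{⊗r} c`. [folklore] -/
theorem tensorSpaceActOver_synthK {N : ℕ} (β : Basis (Fin N) K W) (γ : W ≃ₗ[K] W)
    (c : (Fin r → Fin N) → K) :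
    tensorSpaceActOver γ (synthK β r c) =
      synthK β r (tensorPowerMatrix K N r (LinearMap.toMatrix β β (γ : W →ₗ[K] W)) *ᵥ c) := by
  unfold synthK
  rw [map_sum]
  simp_rw [map_smul, tensorSpaceActOver_basisMonomialK, Finset.smul_sum, smul_smul]
  rw [Finset.sum_comm]
  refine Finset.sum_congr rfl fun w' _ => ?_
  rw [← Finset.sum_smul, Matrix.mulVec, dotProduct]
  congr 1
  refine Finset.sum_congr rfl fun w _ => ?_
  rw [tensorPowerMatrix_apply, mul_comm]

end CoordinatesKFin

/-! ### §2 The comparison map on synthesized tensors -/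

section Comparison

variable (K : Type u) [Field K] [CharZero K] {V : Type} [AddCommGroup V] [Module ℚ V]
variable {N : ℕ} (b : Basis (Fin N) ℚ V) (r : ℕ)

/-- `ι (⊗ᵢ b (w i) ⊗ ()) = ⊗ᵢ (1 ⊗ b (w i)) ⊗ ()`. [folklore] -/
theorem tensorSpaceToBaseChange_basisMonomial (w : Fin r → Fin N) :
    tensorSpaceToBaseChange K V r 0 (basisMonomial b r w) =
      basisMonomialK (Algebra.TensorProduct.basis K b) r w := by
  rw [basisMonomial, tensorSpaceToBaseChange_tprod_tmul_tprod, basisMonomialK,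
    eq_noCovectorK (fun i => Module.Dual.baseChange K (noCovector (V := V) i))]
  congr 2
  funext i
  rw [Algebra.TensorProduct.basis_apply]

/-- `ι (Σ_w c(w) · m_w) = Σ_w c(w) · m^K_w`. [folklore] -/
theorem tensorSpaceToBaseChange_synth (c : (Fin r → Fin N) → ℚ) :
    tensorSpaceToBaseChange K V r 0 (synth b r c) =
      synthK (Algebra.TensorProduct.basis K b) r (fun w => algebraMap ℚ K (c w)) := by
  rw [synth_apply, map_sum]
  unfold synthK
  refine Finset.sum_congr rfl fun w _ => ?_
  rw [map_smul, tensorSpaceToBaseChange_basisMonomial, algebraMap_smul]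

end Comparison

/-! ### §3 Matrices of `K`-automorphisms in the base-changed basis -/

section Matrices

variable (K : Type u) [Field K] [CharZero K] {V : Type} [AddCommGroup V] [Module ℚ V]
variable {N : ℕ} (b : Basis (Fin N) ℚ V)

/-- The matrix of `s_K` in `1 ⊗ b` is the matrix of `s` in `b`. [folklore] -/
theorem toMatrix_baseChange_eq (s : V →ₗ[ℚ] V) :
    LinearMap.toMatrix (Algebra.TensorProduct.basis K b) (Algebra.TensorProduct.basis K b) (s.baseChange K) =
      (LinearMap.toMatrix b b s).map (algebraMap ℚ K) :=
  LinearMap.toMatrix_baseChange K s b b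

/-- The Gram matrix of `Q_K` in `1 ⊗ b` is the Gram matrix of `Q` in `b`. [folklore] -/
theorem toMatrix_bilin_baseChange_eq (Q : LinearMap.BilinForm ℚ V) :
    LinearMap.BilinForm.toMatrix (Algebra.TensorProduct.basis K b) (Q.baseChange K) =
      (LinearMap.BilinForm.toMatrix b Q).map (algebraMap ℚ K) := by
  ext i j
  rw [LinearMap.BilinForm.toMatrix_apply, Matrix.map_apply, LinearMap.BilinForm.toMatrix_apply,
    Algebra.TensorProduct.basis_apply, Algebra.TensorProduct.basis_apply, LinearMap.BilinForm.baseChange_tmul,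
    mul_one, Algebra.algebraMap_eq_smul_one]

variable {K b}

/-- Commutation with `s_K` in matrix form. [folklore] -/
theorem toMatrix_comm_of_comm (s : V →ₗ[ℚ] V) (γ : (K ⊗[ℚ] V) ≃ₗ[K] (K ⊗[ℚ] V))
    (hγ : ∀ x, γ ((s.baseChange K) x) = (s.baseChange K) (γ x)) :
    LinearMap.toMatrix (Algebra.TensorProduct.basis K b) (Algebra.TensorProduct.basis K b)
        (γ : K ⊗[ℚ] V →ₗ[K] K ⊗[ℚ] V) * (LinearMap.toMatrix b b s).map (algebraMap ℚ K) =
      (LinearMap.toMatrix b b s).map (algebraMap ℚ K) *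
        LinearMap.toMatrix (Algebra.TensorProduct.basis K b) (Algebra.TensorProduct.basis K b)
          (γ : K ⊗[ℚ] V →ₗ[K] K ⊗[ℚ] V) := by
  rw [← toMatrix_baseChange_eq K b s, ← LinearMap.toMatrix_mul, ← LinearMap.toMatrix_mul]
  congr 1
  exact LinearMap.ext fun x => hγ x

/-- `Q_K`-isometry in matrix form. [folklore] -/
theorem toMatrix_isometry_of_isometry (Q : LinearMap.BilinForm ℚ V) (γ : (K ⊗[ℚ] V) ≃ₗ[K] (K ⊗[ℚ] V))
    (hγ : ∀ x y, (Q.baseChange K) (γ x) (γ y) = (Q.baseChange K) x y) :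
    (LinearMap.toMatrix (Algebra.TensorProduct.basis K b) (Algebra.TensorProduct.basis K b)
        (γ : K ⊗[ℚ] V →ₗ[K] K ⊗[ℚ] V))ᵀ * (LinearMap.BilinForm.toMatrix b Q).map (algebraMap ℚ K) *
      LinearMap.toMatrix (Algebra.TensorProduct.basis K b) (Algebra.TensorProduct.basis K b)
        (γ : K ⊗[ℚ] V →ₗ[K] K ⊗[ℚ] V) = (LinearMap.BilinForm.toMatrix b Q).map (algebraMap ℚ K) := by
  rw [← toMatrix_bilin_baseChange_eq K b Q, ← LinearMap.BilinForm.toMatrix_comp]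
  congr 1
  exact LinearMap.ext fun x => LinearMap.ext fun y => hγ x y

/-- `det (γ + 1)` in matrix form. [folklore] -/
theorem isUnit_det_one_add_toMatrix (γ : (K ⊗[ℚ] V) ≃ₗ[K] (K ⊗[ℚ] V))
    (hγ : IsUnit (LinearMap.det ((γ : K ⊗[ℚ] V →ₗ[K] K ⊗[ℚ] V) + 1))) :
    IsUnit (1 + LinearMap.toMatrix (Algebra.TensorProduct.basis K b) (Algebra.TensorProduct.basis K b)
      (γ : K ⊗[ℚ] V →ₗ[K] K ⊗[ℚ] V)).det := by
  rw [add_comm, ← LinearMap.toMatrix_one (Algebra.TensorProduct.basis K b), ← map_add, LinearMap.det_toMatrix]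
  exact hγ

omit [CharZero K] in
/-- The matrix of a commutator of automorphisms. [folklore] -/
theorem toMatrix_commutator {W : Type*} [AddCommGroup W] [Module K W] {A : Type*} [Fintype A] [DecidableEq A]
    (β : Basis A K W) (γ δ : W ≃ₗ[K] W) :
    LinearMap.toMatrix β β ((γ * δ * γ⁻¹ * δ⁻¹ : W ≃ₗ[K] W) : W →ₗ[K] W) =
      LinearMap.toMatrix β β (γ : W →ₗ[K] W) * LinearMap.toMatrix β β (δ : W →ₗ[K] W) *
        (LinearMap.toMatrix β β (γ : W →ₗ[K] W))⁻¹ * (LinearMap.toMatrix β β (δ : W →ₗ[K] W))⁻¹ := by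
  have hinv : ∀ ε : W ≃ₗ[K] W, LinearMap.toMatrix β β ((ε⁻¹ : W ≃ₗ[K] W) : W →ₗ[K] W) =
      (LinearMap.toMatrix β β (ε : W →ₗ[K] W))⁻¹ := by
    intro ε
    refine (Matrix.inv_eq_left_inv ?_).symm
    rw [← LinearMap.toMatrix_mul]
    have : ((ε⁻¹ : W ≃ₗ[K] W) : W →ₗ[K] W) * (ε : W →ₗ[K] W) = 1 := by
      ext x; simp
    rw [this, LinearMap.toMatrix_one]
  have hmul : ∀ ε ε' : W ≃ₗ[K] W, LinearMap.toMatrix β β ((ε * ε' : W ≃ₗ[K] W) : W →ₗ[K] W) =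
      LinearMap.toMatrix β β (ε : W →ₗ[K] W) * LinearMap.toMatrix β β (ε' : W →ₗ[K] W) := by
    intro ε ε'
    rw [← LinearMap.toMatrix_mul]
    rfl
  rw [hmul, hmul, hmul, hinv, hinv]

end Matrices

/-! ### §4 The rational side: the tensor hypothesis in coordinates -/

section RationalSide

variable {V : Type} [AddCommGroup V] [Module ℚ V] {N : ℕ} (b : Basis (Fin N) ℚ V) (r : ℕ)

/-- If every commutator of `s`-commuting `Q`-isometries of `V` fixes `t`, then the coordinates of `t` in `b` are
fixed by the Kronecker power of `g h g⁻¹ h⁻¹` for all invertible rational matrices `g, h` commuting with `[s]_b`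
and preserving the Gram matrix of `Q`. [cite: GoodmanWallachGTM255, §5.3.2] -/
theorem coord_commutator_invariant (Q : LinearMap.BilinForm ℚ V) (s : V →ₗ[ℚ] V) (t : hodgeTensorSpace V r 0)
    (ht : ∀ g h : V ≃ₗ[ℚ] V, (∀ x, g (s x) = s (g x)) → (∀ x y, Q (g x) (g y) = Q x y) →
      (∀ x, h (s x) = s (h x)) → (∀ x y, Q (h x) (h y) = Q x y) → tensorSpaceAct (g * h * g⁻¹ * h⁻¹) t = t)
    (g h : Matrix (Fin N) (Fin N) ℚ) (hg : IsUnit g.det) (hh : IsUnit h.det)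
    (hgS : g * LinearMap.toMatrix b b s = LinearMap.toMatrix b b s * g)
    (hhS : h * LinearMap.toMatrix b b s = LinearMap.toMatrix b b s * h)
    (hgG : gᵀ * LinearMap.BilinForm.toMatrix b Q * g = LinearMap.BilinForm.toMatrix b Q)
    (hhG : hᵀ * LinearMap.BilinForm.toMatrix b Q * h = LinearMap.BilinForm.toMatrix b Q) :
    tensorPowerMatrix ℚ N r (g * h * g⁻¹ * h⁻¹) *ᵥ coord b r t = coord b r t := by
  have hinv := ht (Matrix.toLinearEquiv b g hg) (Matrix.toLinearEquiv b h hh) (comm_toLinearEquiv s g hg hgS)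
    (isometry_toLinearEquiv g hg hgG) (comm_toLinearEquiv s h hh hhS) (isometry_toLinearEquiv h hh hhG)
  funext w'
  have hc := coord_invariant b r _ t hinv w'
  rw [toMatrix_commutator b, toMatrix_toLinearEquiv, toMatrix_toLinearEquiv] at hc
  rw [← hc]
  rfl

end RationalSide

/-! ### §5 The statement in the tree's tensor vocabulary -/

section Main

variable (K : Type u) [Field K] [CharZero K]

/-- **Deck-unitary commutator invariance ascends to `K`-points (Cayley-parametrised part), tensor form.**
For a finite-dimensional `ℚ`-space `V` with a symmetric nondegenerate form `Q` and a `Q`-isometry `s` with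
`s ^ p = 1` (`p > 0`): if `t ∈ T^{r,0} V` is fixed by every commutator of `s`-commuting `Q`-isometries of `V`, then
`ι t ∈ T^{r,0}_K (K ⊗ V)` is fixed by `γ δ γ⁻¹ δ⁻¹` for all `K`-automorphisms `γ, δ` of `K ⊗ V` commuting with `s_K`,
preserving `Q_K` and with `det (γ + 1)`, `det (δ + 1)` invertible.
[cite: GoodmanWallachGTM255, Exercises 1.4.5 #5 and §2.2.3 Exercise 1] -/
theorem tensorSpaceActOver_commutator_eq {V : Type} [AddCommGroup V] [Module ℚ V] [Module.Finite ℚ V]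
    (Q : LinearMap.BilinForm ℚ V) (s : V →ₗ[ℚ] V) {p : ℕ} (hp : 0 < p) (hQ : Q.Nondegenerate)
    (hQs : ∀ x y, Q x y = Q y x) (hsp : s ^ p = 1) (hsQ : ∀ x y, Q (s x) (s y) = Q x y)
    (r : ℕ) (t : hodgeTensorSpace V r 0)
    (ht : ∀ g h : V ≃ₗ[ℚ] V, (∀ x, g (s x) = s (g x)) → (∀ x y, Q (g x) (g y) = Q x y) →
      (∀ x, h (s x) = s (h x)) → (∀ x y, Q (h x) (h y) = Q x y) → tensorSpaceAct (g * h * g⁻¹ * h⁻¹) t = t)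
    (γ δ : (K ⊗[ℚ] V) ≃ₗ[K] (K ⊗[ℚ] V))
    (hγs : ∀ x, γ ((s.baseChange K) x) = (s.baseChange K) (γ x))
    (hδs : ∀ x, δ ((s.baseChange K) x) = (s.baseChange K) (δ x))
    (hγQ : ∀ x y, (Q.baseChange K) (γ x) (γ y) = (Q.baseChange K) x y)
    (hδQ : ∀ x y, (Q.baseChange K) (δ x) (δ y) = (Q.baseChange K) x y)
    (hγ1 : IsUnit (LinearMap.det ((γ : K ⊗[ℚ] V →ₗ[K] K ⊗[ℚ] V) + 1)))
    (hδ1 : IsUnit (LinearMap.det ((δ : K ⊗[ℚ] V →ₗ[K] K ⊗[ℚ] V) + 1))) :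
    tensorSpaceActOver (γ * δ * γ⁻¹ * δ⁻¹) (tensorSpaceToBaseChange K V r 0 t) =
      tensorSpaceToBaseChange K V r 0 t := by
  set b := Module.finBasis ℚ V with hb
  set S := LinearMap.toMatrix b b s with hS
  set G := LinearMap.BilinForm.toMatrix b Q with hG
  -- the hypotheses of the coordinate theorem
  have hSp : S ^ p = 1 := by
    have e : S = LinearMap.toMatrixAlgEquiv b s := rfl
    rw [e, ← map_pow, hsp, map_one]
  have hSG : Sᵀ * G * S = G := by
    have e : Q.comp s s = Q := LinearMap.ext fun x => LinearMap.ext fun y => hsQ x y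
    rw [hS, hG, ← LinearMap.BilinForm.toMatrix_comp b b, e]
  have hGt : Gᵀ = G := by
    ext i j
    rw [transpose_apply, hG, LinearMap.BilinForm.toMatrix_apply, LinearMap.BilinForm.toMatrix_apply, hQs]
  have hGu : IsUnit G.det := isUnit_iff_ne_zero.mpr ((LinearMap.BilinForm.nondegenerate_iff_det_ne_zero b).mp hQ)
  -- the coordinate theorem, at the matrices of `γ`, `δ` in the basis `1 ⊗ b`
  have key := commutator_invariance_ascends S G hp hSp hSG hGt hGu (coord b r t)
    (coord_commutator_invariant b r Q s t ht)
    (LinearMap.toMatrix (Algebra.TensorProduct.basis K b) (Algebra.TensorProduct.basis K b)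
      (γ : K ⊗[ℚ] V →ₗ[K] K ⊗[ℚ] V))
    (LinearMap.toMatrix (Algebra.TensorProduct.basis K b) (Algebra.TensorProduct.basis K b)
      (δ : K ⊗[ℚ] V →ₗ[K] K ⊗[ℚ] V))
    (isUnit_det_one_add_toMatrix γ hγ1) (isUnit_det_one_add_toMatrix δ hδ1)
    (toMatrix_comm_of_comm s γ hγs) (toMatrix_comm_of_comm s δ hδs)
    (toMatrix_isometry_of_isometry Q γ hγQ) (toMatrix_isometry_of_isometry Q δ hδQ)
  rw [← synth_coord b r t, tensorSpaceToBaseChange_synth, tensorSpaceActOver_synthK, toMatrix_commutator, key]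

end Main

/-! ### §6 The registered stub D₁ of line `unitary-kunneth-fft` v5 (crux K2-A), verbatim -/

/-- **Stub D₁ `stub_deckUnitaryCommutatorAscent`** (K2-A skeleton v5, stmt-HodgeConjecture-19545), registered
signature verbatim: deck-unitary commutator invariance of a tensor ascends from `ℚ`-points to the
Cayley-parametrised `ℂ`-points.  Proof: `tensorSpaceActOver_commutator_eq` at `K = ℂ` (the binders `p.Prime`,
`3 ≤ p` are only used through `0 < p`). [cite: GoodmanWallachGTM255, Exercises 1.4.5 #5 and §2.2.3 Exercise 1] -/
theorem stub_deckUnitaryCommutatorAscent :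
    open Literature.AlgebraicGeometry.Motives Literature.AlgebraicGeometry.HodgeTheory Literature.AlgebraicGeometry.HodgeTheory.BettiUniverse CategoryTheory.Limits in ∀ (V : Type) [AddCommGroup V] [Module ℚ V] [Module.Finite ℚ V] (Q : LinearMap.BilinForm ℚ V) (s : V →ₗ[ℚ] V) (p : ℕ), p.Prime → 3 ≤ p → Q.Nondegenerate → (∀ x y, Q x y = Q y x) → s ^ p = 1 → (∀ x y, Q (s x) (s y) = Q x y) → ∀ (r : ℕ) (t : hodgeTensorSpace V r 0), (∀ g h : V ≃ₗ[ℚ] V, (∀ x, g (s x) = s (g x)) → (∀ x y, Q (g x) (g y) = Q x y) → (∀ x, h (s x) = s (h x)) → (∀ x y, Q (h x) (h y) = Q x y) → tensorSpaceAct (g * h * g⁻¹ * h⁻¹) t = t) → (∀ γ δ : (ℂ ⊗[ℚ] V) ≃ₗ[ℂ] (ℂ ⊗[ℚ] V), (∀ x, γ ((s.baseChange ℂ) x) = (s.baseChange ℂ) (γ x)) → (∀ x y, (LinearMap.BilinForm.baseChange ℂ Q) (γ x) (γ y) = (LinearMap.BilinForm.baseChange ℂ Q) x y) → (∀ x, δ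 ((s.baseChange ℂ) x) = (s.baseChange ℂ) (δ x)) → (∀ x y, (LinearMap.BilinForm.baseChange ℂ Q) (δ x) (δ y) = (LinearMap.BilinForm.baseChange ℂ Q) x y) → IsUnit (LinearMap.det (((γ : (ℂ ⊗[ℚ] V) ≃ₗ[ℂ] (ℂ ⊗[ℚ] V)) : (ℂ ⊗[ℚ] V) →ₗ[ℂ] (ℂ ⊗[ℚ] V)) + 1)) → IsUnit (LinearMap.det (((δ : (ℂ ⊗[ℚ] V) ≃ₗ[ℂ] (ℂ ⊗[ℚ] V)) : (ℂ ⊗[ℚ] V) →ₗ[ℂ] (ℂ ⊗[ℚ] V)) + 1)) → tensorSpaceActOver (γ * δ * γ⁻¹ * δ⁻¹) (tensorSpaceToBaseChange ℂ V r 0 t) = (tensorSpaceToBaseChange ℂ V r 0 t)) := by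
  intro V _ _ _ Q s p hp _ hQ hQs hsp hsQ r t ht γ δ hγs hγQ hδs hδQ hγ1 hδ1
  exact tensorSpaceActOver_commutator_eq ℂ Q s hp.pos hQ hQs hsp hsQ r t ht γ δ hγs hδs hγQ hδQ hγ1 hδ1




end Summit.HodgeConjecture.HodgeConjecture.Theorems.CyclicUnitaryPowersDeckUnitaryCayleyAscent

end
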